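import Summits.ResolutionOfSingularities.ResolutionOfSingularities.Theorems.FrobeniusClosingSteerArithLeafWords
import Summits.ResolutionOfSingularities.ResolutionOfSingularities.Theorems.FrobeniusClosingSteerShadowVacuous
import HarnessLib

/-!
# Crux `Steer` (stmt-ResolutionOfSingularities-16345), chain W4.1 — **(W-Hγ) `ArithLeaf.EventuallyOnlyExcStripsTwoN` HOLDS**
# (S1c «beyond a bound, between two visits every step is the strip along the exceptional divisor»; def-free, Theses-free, 0 sorries)

OURS (campaign `res-hironaka`, rung L ★L-G4, slot W4.1; seat res-D-pv-053 g9 on res-L0-w41-plan-1 RULING 265 (b); author/objector of the word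
res-L0-w41-strat-2). Candidates, not facts; nothing here is a statement of H. Hironakaʼs manuscript [Hironaka2017] (status: under review).
AI-written; AI review is weaker than expert review.

THE WORD (`…ArithLeafWords`, p559461): along a σ_top-steered run from a `NormalAt` core datum (`p = 2`, `n = 4`, rank one), under the hARᵒ
binders and run hygiene, there is a bound `N₂` such that for every visit pair `j < j′` with `N₂ ≤ j` and every exceptional parameter `x` of the
point step `j`, every step `l` strictly between `j` and `j′` has centre `P l = (x)`.

PROOF (no clord count). `N₂ := N₃`, the bound beyond which every positive-dimensional step has height `< 2`
(`ArithReduction.exists_bound_of_not_infinite_posStepTwo` on `¬ HeightTwoStepsInfinite`). Strong induction on `l`: all steps in `(j, l)` are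
`x`-strips, so `R l = R (j+1)` (`VisitLawTelescope.ring_const_of_strips`) and `s (j+1) = s l · x^m · W + G` with `G ∈ R l`, `W` a unit of `R l`
(`VisitLawTelescope.visitLaw_telescope` from `j+1`, where `x` is exceptional along its own strip). The step `l` is positive of height `< 2` and its
centre contains a non-zero element, so `P l = (q)` with `q` prime (`NoHeightOneCarrier.exists_eq_span_singleton_of_height_eq_one`), and it is
σ_top-PERMISSIBLE, so `(s l)² − γ² ∈ (q)²`: a square carrier `(s l)² = γ² + q²u`, hence (characteristic two) a carrier of `s (j+1)` over
`R l = R (j+1)`: `(s (j+1))² = (γ x^m W + G)² + q² · (u x^{2m} W²)`. The point-step member `R j` is `NormalAt` for `s j`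
(`MaxVacuity.normalAt_of_pointStep_along_run`, i.e. (N4) + the carrier dichotomy), so by the «carrier off the exceptional divisor» engine
`NoSingularCarrier.false_of_normalAt_of_carrier_off_exceptional` the prime `q` divides the chart parameter `x₀` of the blow-up at `j`; `x₀ = w·x`
with `w` a unit (`VisitLawTelescope.excParam_eq_unit_mul`), `x` is prime in `R (j+1)` (`VisitLawPointStep.prime_excParam_succ`), so `(q) = (x)`
(height-one sandwich `Ideal.eq_of_le_of_height_le`), i.e. `P l = (x)`. Only the binders `CoreDatum`, `¬HasProperCoarsening`, `R 0 = locAtCentre A₀ O`,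
`NormalAt`, `IsSteeredRun`, `¬HeightTwoStepsInfinite`, regularity and dimension of the members are consumed; the other binders of the word are idle.
-/

-- `Summit.<S>.<S>.…` duplicates the summit name by design (single-problem summit).
set_option linter.dupNamespace false

open IsLocalRing
open Literature.AlgebraicGeometry.Resolution
open Summit.ResolutionOfSingularities.ResolutionOfSingularities.Theorems.SwitchingDichotomy.Words
open Summit.ResolutionOfSingularities.ResolutionOfSingularities.Theorems.SteerRankThinness (Concl HasProperCoarsening)
open Summit.ResolutionOfSingularities.ResolutionOfSingularities.Theorems.SwitchingDichotomy

namespace Summit.ResolutionOfSingularities.ResolutionOfSingularities.Theorems.SwitchingDichotomy.ArithLeaf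

namespace OnlyExcStrips

variable {K : Type} [Field K] {O : ValuationSubring K} {R : ℕ → Subring K} {P : (i : ℕ) → Ideal (R i)} {t : K} {s : ℕ → K}

/-! ## §1 Run bookkeeping -/

/-- Along the strip `P i = (x)` of a member `R i ≤ O`, the generator `x` is itself an exceptional parameter of the step (every `a·x`, `a ∈ R i ⊆ O`,
has value `≤ v(x)`). [cite: NovacoskiSpivakovsky2014, Def. 2.11] [folklore] -/
theorem excParam_of_strip {i : ℕ} (hRO : R i ≤ O.toSubring) {x : K} (hx0 : x ≠ 0) (hxi : x ∈ R i)
    (hP : P i = Ideal.span {(⟨x, hxi⟩ : R i)}) :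
    (∃ h : x ∈ R i, (⟨x, h⟩ : R i) ∈ P i) ∧ x ≠ 0 ∧ ∀ y : R i, y ∈ P i → O.valuation (y : K) ≤ O.valuation x := by
  refine ⟨⟨hxi, hP ▸ Ideal.mem_span_singleton_self _⟩, hx0, fun y hy => ?_⟩
  rw [hP, Ideal.mem_span_singleton'] at hy
  obtain ⟨a, rfl⟩ := hy
  have ha : O.valuation (a : K) ≤ 1 := (O.valuation_le_one_iff _).mpr (hRO a.2)
  calc O.valuation (((a * ⟨x, hxi⟩ : R i) : K)) = O.valuation (a : K) * O.valuation x := by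
        rw [Subring.coe_mul, map_mul]
    _ ≤ 1 * O.valuation x := by gcongr
    _ = O.valuation x := one_mul _

/-- **A late positive step is a principal prime carrier.** At a NON-point step `k` of a steered run at `p = 2` whose centre has height `< 2` and whose
member is regular, `P k = (q)` with `q` prime and the radicand is a square carrier `(s k)² = γ² + q²·u` over `R k` (the centre is σ_top-permissible,
so `(s k)² − γ² ∈ (q)²`; it is not `⊥` because the step has a non-zero exceptional parameter). [cite: Matsumura1987, Thm. 20.3] [folklore] -/
theorem principal_carrier_of_strip (hrun : IsSteeredRun O R P t 2 s) {k : ℕ} (hreg : IsRegularLocalRing (R k))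
    (hnpt : ¬ IsPointStep R P k) (hlt : (P k).height < 2) :
    ∃ (q : R k), Prime q ∧ P k = Ideal.span {q} ∧
      ∃ γ u : K, γ ∈ R k ∧ u ∈ R k ∧ s k ^ 2 = γ ^ 2 + (q : K) ^ 2 * u := by
  classical
  haveI := hreg
  obtain ⟨_, hs, hcentre, -, x', g', ⟨⟨hx'R, hx'P⟩, hx'0, -⟩, -, -⟩ := hrun.2 k
  -- the centre is permissible (not the point disjunct)
  have hperm : IsPermissibleCentre (R k) 2 ⟨s k ^ 2, hs⟩ (P k) := by
    rcases hcentre with hperm | ⟨hPm, -, -⟩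
    · exact hperm
    · exact absurd ⟨‹_›, hPm⟩ hnpt
  obtain ⟨-, ⟨hprime, -⟩, -, γ, hγ⟩ := hperm
  haveI := hprime
  -- height exactly one: `< 2` and `≠ ⊥`
  have hne : P k ≠ ⊥ := fun h => by
    have : (⟨x', hx'R⟩ : R k) = 0 := by simpa [h] using hx'P
    exact hx'0 (congrArg Subtype.val this)
  have hht : (P k).height = 1 := by
    have hne0 : (P k).height ≠ 0 := fun h => hne (Ideal.height_eq_zero_iff_eq_bot.mp h)
    have hnetop : (P k).height ≠ ⊤ := ne_top_of_lt hlt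
    obtain ⟨m, hm⟩ := ENat.ne_top_iff_exists.mp hnetop
    rw [← hm] at hlt hne0 ⊢
    have h2 : m < 2 := by exact_mod_cast hlt
    have h0 : m ≠ 0 := fun h => hne0 (by rw [h]; rfl)
    have : m = 1 := by omega
    rw [this]; rfl
  obtain ⟨q, hPq, hq⟩ := NoHeightOneCarrier.exists_eq_span_singleton_of_height_eq_one (R k) (P k) hht
  refine ⟨q, hq, hPq, ?_⟩
  -- the carrier from `f − γ² ∈ (q)² = (q²)`
  rw [hPq, Ideal.span_singleton_pow] at hγ
  obtain ⟨u, hu⟩ := Ideal.mem_span_singleton'.mp hγ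
  refine ⟨(γ : K), (u : K), γ.2, u.2, ?_⟩
  have e : (⟨s k ^ 2, hs⟩ : R k) = γ ^ 2 + q ^ 2 * u := by rw [mul_comm, hu]; ring
  have := congrArg Subtype.val e
  simpa using this

/-- `x ∈ R`, prime as an element of a member `S = R (j+1)`, stays prime as an element of any member `R k` EQUAL to `S` (transport along `R k = R (j+1)`).
[folklore] -/
theorem prime_transport {S S' : Subring K} (h : S' = S) {x : K} (hxS : x ∈ S) (hp : Prime (⟨x, hxS⟩ : S)) (hxS' : x ∈ S') :
    Prime (⟨x, hxS'⟩ : S') := by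
  subst h
  exact hp

end OnlyExcStrips

/-! ## §2 The word -/

open OnlyExcStrips in
/-- **(W-Hγ) HOLDS** — `ArithLeaf.EventuallyOnlyExcStripsTwoN` with the bound `N₂ = N₃` («no positive step of height ≥ 2 beyond `N₃`»). See the module
docstring for the proof. OURS. [cite: Matsumura1987, Thm. 20.3] [cite: NovacoskiSpivakovsky2014, Def. 2.11] [folklore] -/
theorem eventuallyOnlyExcStripsTwoN_holds : EventuallyOnlyExcStripsTwoN := by
  intro p hp2 k K _ _ _ _ _ O A₀ h₀ t core hrk R P s hR0 hN hrun hnd hhigh h2inf hinf hwild hnp hodd hreg hdim N₁ h0 h1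
  subst hp2
  classical
  haveI : Fact (Nat.Prime 2) := ⟨Nat.prime_two⟩
  haveI : CharP K 2 := charP_of_injective_algebraMap (algebraMap k K).injective 2
  -- run bookkeeping
  obtain ⟨-, -, hdim', -, hirr, -⟩ := runHygieneTwo_holds 2 rfl k K O A₀ h₀ t core hrk R P s hR0 hrun
  have hRO : R 0 ≤ O.toSubring := hR0 ▸ locAtCentre_le h₀
  have hloc : locAtCentre (R 0) O = R 0 := by rw [hR0]; exact locAtCentre_locAtCentre A₀.toSubring O
  have hdom0 : SubringDominates (R 0) O.toSubring := by
    rw [hR0]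
    exact subringDominates_locAtCentre h₀
  have hbl : ∀ i, IsLocalBlowupAlong O (R i) (P i) (R (i + 1)) := fun i => VisitLawPointStep.isLocalBlowupAlong_of_run hrun i
  have hmem := NoSingularCarrier.le_and_locAtCentre_eq_of_run R P hRO hloc hbl
  have hval : ∀ i, ∀ a : R i, a ∈ maximalIdeal (R i) ↔ O.valuation (a : K) < 1 := fun i => by
    haveI := hreg i
    exact NoSingularCarrier.mem_maximalIdeal_iff_of_locAtCentre_eq (hmem i).1 (hmem i).2
  have hN5 : ∀ i, ∀ hs : s i ^ 2 ∈ R i, ∀ π a b c : R i, Prime π → ¬ π ∣ b →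
      b ^ 2 * ⟨s i ^ 2, hs⟩ = a ^ 2 + π ^ 2 * c → ∃ g₀ u₀ : R i, (⟨s i ^ 2, hs⟩ : R i) = g₀ ^ 2 + π ^ 2 * u₀ :=
    fun i hs π a b c hπ hπb heq => MaxVacuity.memberFrobeniusCongruence_two k K O A₀ h₀ t core R P s hR0 hrun i hs π a b c hπ hπb heq
  -- `NormalAt` at every point step ((N4) + the carrier dichotomy)
  have hNpt : ∀ j, IsPointStep R P j → NormalAt O (R j) 2 (s j) := fun j hPj =>
    MaxVacuity.normalAt_of_pointStep_along_run 2 O R P t s (n := 4) (by norm_num) hreg hdim' hRO hloc hirr hN5 hN hrun j hPj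
  -- lateness: beyond `N₃` every positive step has height `< 2`
  obtain ⟨N₃, hlate⟩ := ArithReduction.exists_bound_of_not_infinite_posStepTwo (R := R) (P := P) (fun h => h2inf h)
  refine ⟨N₃, ?_⟩
  intro j j' x hj hvisit hx
  obtain ⟨hjj', hPj, -, hbetween⟩ := hvisit
  -- data of the point step `j`
  haveI := hreg j
  haveI := hreg (j + 1)
  have hx1 : x ∈ R (j + 1) := (hbl j).isLocalBlowup.le hx.1.fst
  have hxprime : Prime (⟨x, hx1⟩ : R (j + 1)) := (VisitLawPointStep.prime_excParam_succ hrun hdom0 hPj (hreg j) (hreg (j + 1)) hx hx1).2.2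
  have hxv : O.valuation x < 1 := by
    obtain ⟨hxR, hxP⟩ := hx.1
    obtain ⟨_, hPm⟩ := hPj
    have : (⟨x, hxR⟩ : R j) ∈ maximalIdeal (R j) := by rw [← hPm]; exact hxP
    exact (hval j _).mp this
  -- the chart of the blow-up at `j` and the strict-transform step
  obtain ⟨x₀, hx₀P, hx₀0, hmax₀, hR'⟩ := SteeredRun.exists_eq_locAtCentre_of_isLocalBlowupAlong (hbl j)
  have hx₀0K : ((x₀ : R j) : K) ≠ 0 := fun h => hx₀0 (Subtype.ext h)
  have hx₀' : (∃ h : (x₀ : K) ∈ R j, (⟨(x₀ : K), h⟩ : R j) ∈ P j) ∧ (x₀ : K) ≠ 0 ∧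
      ∀ y : R j, y ∈ P j → O.valuation (y : K) ≤ O.valuation (x₀ : K) := ⟨⟨x₀.2, by simpa using hx₀P⟩, hx₀0K, hmax₀⟩
  obtain ⟨w, hw, hwinv, hxw⟩ := VisitLawTelescope.excParam_eq_unit_mul (hbl j) hx hx₀'
  obtain ⟨xj, gj, ⟨⟨hxjR, -⟩, -, -⟩, hgj, hstepj⟩ := VisitLawPointStep.step_of_run hrun j
  have hsj : s j ^ 2 ∈ R j := VisitLawPointStep.pow_mem_of_run hrun j
  -- strong induction on the position `l` strictly between the visits
  suffices key : ∀ d l, l = j + 1 + d → l < j' → ∃ hx : x ∈ R l, P l = Ideal.span {(⟨x, hx⟩ : R l)} by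
    intro l hjl hlj'
    exact key (l - (j + 1)) l (by omega) hlj'
  intro d
  induction d using Nat.strong_induction_on with
  | _ d ih =>
  intro l hl hlj'
  -- every step strictly between `j` and `l` is the `x`-strip
  have IH : ∀ k', j < k' → k' < l → ∃ hx : x ∈ R k', P k' = Ideal.span {(⟨x, hx⟩ : R k')} :=
    fun k' hjk' hk'l => ih (k' - (j + 1)) (by omega) k' (by omega) (by omega)
  have hconst := VisitLawTelescope.ring_const_of_strips hbl IH
  have hRl : R l = R (j + 1) := hconst l (by omega) le_rfl
  haveI := hreg l
  have hxl : x ∈ R l := hRl ▸ hx1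
  -- the telescope from `j+1` to `l`: `s (j+1) = s l · x^m · W + G`
  have htel : ∃ (m : ℕ) (G W : K), G ∈ R l ∧ W ∈ R l ∧ s (j + 1) = s l * x ^ m * W + G := by
    by_cases hjl : j + 1 < l
    · obtain ⟨hxj1, hPj1⟩ := IH (j + 1) (by omega) hjl
      have hxe := excParam_of_strip (hmem (j + 1)).1 hx.2.1 hxj1 hPj1
      obtain ⟨-, G, W, hG, hW, -, -, hlaw⟩ := VisitLawTelescope.visitLaw_telescope hrun hdom0 hjl hxe
        (fun k' hk' hk'l => IH k' (by omega) hk'l)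
      exact ⟨l - (j + 1), G, W, hG, hW, by linear_combination (-1 : K) * hlaw⟩
    · have hl1 : l = j + 1 := by omega
      subst hl1
      exact ⟨0, 0, 1, (R (j + 1)).zero_mem, (R (j + 1)).one_mem, by ring⟩
  obtain ⟨m, G, W, hG, hW, hlaw⟩ := htel
  -- the step `l`: a principal prime carrier `(s l)² = γ² + q² u`, `P l = (q)`
  have hnpt : ¬ IsPointStep R P l := hbetween l (by omega) hlj'
  have hpos : SigmaTopLegality.IsPosStep R P l := by
    obtain ⟨hlocl, -⟩ := hrun.2 l
    exact ⟨hlocl, fun h => hnpt ⟨hlocl, h⟩⟩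
  have hlt : (P l).height < 2 := hlate l (by omega) hpos
  obtain ⟨q, hq, hPq, γ, u, hγ, hu, hcar⟩ := principal_carrier_of_strip hrun (hreg l) hnpt hlt
  -- the induced carrier of `s (j+1)` over `R l` (characteristic two)
  have h2 : (2 : K) = 0 := by exact_mod_cast CharP.cast_eq_zero K 2
  have hcar' : s (j + 1) ^ 2 = (γ * x ^ m * W + G) ^ 2 + (q : K) ^ 2 * (u * (x ^ m) ^ 2 * W ^ 2) := by
    rw [hlaw]
    linear_combination ((x ^ m) ^ 2 * W ^ 2) * hcar + (x ^ m * W * G * (s l - γ)) * h2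
  have hG' : γ * x ^ m * W + G ∈ R l := (R l).add_mem ((R l).mul_mem ((R l).mul_mem hγ ((R l).pow_mem hxl m)) hW) hG
  have hU' : u * (x ^ m) ^ 2 * W ^ 2 ∈ R l := (R l).mul_mem ((R l).mul_mem hu ((R l).pow_mem ((R l).pow_mem hxl m) 2)) ((R l).pow_mem hW 2)
  -- the engine: `q` divides the chart parameter `x₀`
  have hRl' : R l = locAtCentre (Subring.closure ((R j : Set K) ∪ (fun y : R j => (y : K) / (x₀ : K)) '' (P j : Set (R j)))) O := by
    rw [hRl]; exact hR'
  have hRR' : R j ≤ R l := fun y hy => hRl ▸ (hbl j).isLocalBlowup.le hy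
  have hqx₀ : q ∣ (⟨(x₀ : K), hRR' x₀.2⟩ : R l) := by
    by_contra hndvd
    exact NoSingularCarrier.false_of_normalAt_of_carrier_off_exceptional 2 O (hval j) x₀.2 hx₀0K hRl' hRR' hxjR hgj hstepj hsj
      (hNpt j hPj) (hN5 j hsj) hG' q.2 hU' hcar' q hq (dvd_refl q) hndvd
  -- `(q) = (x)` in `R l`
  have hxlprime : Prime (⟨x, hxl⟩ : R l) := prime_transport hRl hx1 hxprime hxl
  have hwl : w ∈ R l := hRl ▸ hw
  have hwinvl : w⁻¹ ∈ R l := hRl ▸ hwinv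
  have hqx : q ∣ (⟨x, hxl⟩ : R l) := by
    have hw0 : w ≠ 0 := fun h => hx₀0K (by rw [hxw, h, zero_mul])
    have e : (⟨x, hxl⟩ : R l) = ⟨w⁻¹, hwinvl⟩ * ⟨(x₀ : K), hRR' x₀.2⟩ := by
      apply Subtype.ext
      change x = w⁻¹ * (x₀ : K)
      rw [hxw, ← mul_assoc, inv_mul_cancel₀ hw0, one_mul]
    rw [e]
    exact Dvd.dvd.mul_left hqx₀ _
  have heq : Ideal.span {q} = Ideal.span {(⟨x, hxl⟩ : R l)} := by
    haveI hqI : (Ideal.span {q}).IsPrime := (Ideal.span_singleton_prime hq.ne_zero).mpr hq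
    have hle : Ideal.span {(⟨x, hxl⟩ : R l)} ≤ Ideal.span {q} := Ideal.span_singleton_le_span_singleton.mpr hqx
    haveI hxI : (Ideal.span {(⟨x, hxl⟩ : R l)}).IsPrime := (Ideal.span_singleton_prime hxlprime.ne_zero).mpr hxlprime
    have hxht : (Ideal.span {(⟨x, hxl⟩ : R l)}).height = 1 :=
      Ideal.height_span_singleton_eq_one_of_mem_nonZeroDivisors (mem_nonZeroDivisors_of_ne_zero hxlprime.ne_zero) hxlprime.not_unit
    have hqht : (Ideal.span {q}).height ≤ 1 := Ideal.height_span_singleton_le_one hq.not_unit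
    exact ((Ideal.span {(⟨x, hxl⟩ : R l)}).eq_of_le_of_height_le hle (hqht.trans hxht.ge)).symm
  exact ⟨hxl, hPq.trans heq⟩

end Summit.ResolutionOfSingularities.ResolutionOfSingularities.Theorems.SwitchingDichotomy.ArithLeaf
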